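/-
Copyright (c) 2026 the pub-hodgecm-mathlib formalisation cell (harness21).  Prover seat hodgecm-mathlib-K2E1-p16 (g2), Track B «K2-LIT» ENGINE E1, h413 = `stmt-HodgeConjecture-24833`,
route `HCCMUnconditional`, R90-S8 «ContSpec-n½» TWIN-DAG row 6 (dealer R90-CS-plan (g2), S8-R19 (D)) — the `N = 3` twin of ★ `K2E1ChiEisensteinMeromorphicExportsU2GlobalCM` (K2E1-p14):
X2_χ (A) AT THE CM PAIR on `U(2,1)_{L∕L⁺}`.
-/
import Summits.HodgeConjecture.HodgeConjecture.Theorems.K2E1ChiEisensteinBallPackageCMThreeScalar      -- ★ row 5 part 2 (this seat, p862146): the per-ball package with (R4), PAIR currency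
import Summits.HodgeConjecture.HodgeConjecture.Theorems.K2E1ChiEisensteinMeromorphicExportsU3Global    -- ★ (B-1) (R90-CS-p03): X2_χ core at `N = 3` `chiEisenstein_meromorphic_exports_core_of_packages_cm_three`
import Summits.HodgeConjecture.HodgeConjecture.Theorems.K2E1ChiEisensteinMeromorphicExportsU2GlobalCM  -- ★ (K2E1-p14): `meromorphicOn_apply_of_pi`; brings ★ `meromorphicOn_patch_of_coDiscrete` (rank-free)
import HarnessLib

/-!
# h413 ∕ Track B «K2-LIT», R90-S8 TWIN-DAG row 6 — `K2E1ChiEisensteinMeromorphicExportsU3GlobalCM` (X2_χ (A) at the CM pair, `N = 3`): THE MEROMORPHIC CONTINUATION TO `ℂ` OF THE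
# `(χ₁, χ₂)` EISENSTEIN SERIES `E(f_z^φ)` OF `U(2,1)_{L∕L⁺}` AND OF ITS SCATTERING COORDINATES, with ONE closed discrete pole set `P ⊆ {Re ≤ 2}` — hypothesis-first on the per-ball
# convolution data (with the scalar-action clause) and on the Godement-half-plane scattering coordinates `q_j`

Cell `pub/hodgecm-mathlib`, crux H413 = `stmt-HodgeConjecture-24833`; dealer R90-CS-plan (g2) S8-R19 (D) «row 6 = K2E1-p16».  THEOREMS ONLY (no `def`, no `instance`, no `notation`,
no named-fact hypothesis, no `sorry`); lane `--kind proof --supports stmt-HodgeConjecture-24833 --as helper` (count-neutral).  The token-for-token `N = 3` twin of ★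
`K2E1ChiEisensteinMeromorphicExportsU2GlobalCM.chiEisenstein_meromorphic_exports_cm_two_of_letters` (K2E1-p14) in the PAIR CURRENCY of ★ rows 4∕5 (`φ` a continuous bounded
`(χ₁, χ₂)`-section, `χ₂` automorphic; columns `φ′_j` linearly independent continuous bounded `(χ₁′, χ₂′)`-sections, `χ₂′` automorphic): `2 ↦ 3`, weight `n+3 ↦ n+4`, Godement
half-plane `{1 < Re} ↦ {2 < Re}`, pole set `P ⊆ {Re ≤ 2}`, first ball `n₀ = 0 ↦ 1`.

THE MATHEMATICS [BernsteinLapid2019, Thm 2.3, §2.1, §4, §7; MoeglinWaldspurger1995, IV.1.8–IV.1.11].  For SCATTERING COORDINATES `q_j` HOLOMORPHIC on `{2 < Re}` with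
`Σ_j q_j(z) φ′_j = (ν𝓕)⁻¹·φ̃_z` there (letters `hq`, `hqφ`; payer ★ row 7c `exists_scatteringCoords_cm_three`), and PER BALL `n` the convolution data of ★ `exists_convData_cm_three` ∕ ★
convData_χ together with the scalar-action clause `hS1` (letter bundle `hCD`, total in `n`), this file proves the EXPORTS (E1)–(E4) for the family `E(f_z^φ)`: **`Ec : ℂ → G(𝔸) → ℂ` with
`z ↦ Ec z g` MEROMORPHIC IN NORMAL FORM ON `ℂ` for every `g`, the continued scattering coordinates `qc_j` MEROMORPHIC IN NORMAL FORM ON `ℂ`, `Ec z = E(f_z^φ)` and `qc_j z = q_j z` for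
`2 < Re z`, ONE closed discrete pole set `P ⊆ {Re ≤ 2}` off which every `Ec · g` and every `qc_j` is analytic, and `g ↦ Ec z g` CONTINUOUS for `z ∉ P`** — by choosing over `n ≥ 1` the
per-ball packages of ★ row 5 part 2 (`exists_chiPair_ball_package_cm_three_of_letters'`, coordinates `bX z := (q_j z)_j`; the ball `n = 0` carries no Godement point at `N = 3`, so the
package needs `0 < n` and the chosen witnesses are made total in `n` by the two `exists…_imp_of` lemmas — only `1 ≤ n` is consumed), patching the coefficient pieces `cc_n(·)_j` to `q_j` on
the Godement half-plane (★ `meromorphicOn_patch_of_coDiscrete`, `σ₀ = 2`), and ONE call of ★ X2_χ core at `N = 3` `chiEisenstein_meromorphic_exports_core_of_packages_cm_three` (R90-CS-p03;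
`n₀ := 1`).
HONEST LABEL: HC_CM is proved only modulo the 7 printed citations (2 remaining named inputs: hLiu418 = `stmt-HodgeConjecture-24832`, h413 = `stmt-HodgeConjecture-24833`) until rung 0
closes; count-neutral helper, closes no socket; the letters `hCD` (per-ball convolution data WITH the scalar-action clause) and `hq`∕`hqφ` are NOT proved here.

## References
* [BernsteinLapid2019] J. Bernstein, E. Lapid, *On the meromorphic continuation of Eisenstein series*, J. Amer. Math. Soc. 37 (2024) (arXiv:1911.02342), Thm 2.3, §2.1, §4, §7.
* [MoeglinWaldspurger1995] C. Mœglin, J.-L. Waldspurger, *Spectral Decomposition and Eisenstein Series* (1995), IV.1.8–IV.1.11.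
-/

set_option autoImplicit false
-- the mandated namespace repeats `HodgeConjecture.HodgeConjecture`, as in every `Theorems/*.lean` of this sub-problem
set_option linter.dupNamespace false

noncomputable section

open MeasureTheory Measure Filter Topology Set NumberField IsDedekindDomain
open scoped NNReal ENNReal Classical ComplexConjugate
open Literature.MeasureTheory.Group Literature.NumberTheory Literature.NumberTheory.Automorphic Literature.NumberTheory.Automorphic.UnitaryGroup AdelicGroupData
open Literature.NumberTheory.Automorphic.Arthur2013.Leaves.TECR
open Literature.NumberTheory.GaloisRepresentations (HeckeCharacter)
open Summit.HodgeConjecture.HodgeConjecture.Cruxes.H413.K2E1BorelEisensteinU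
open Summit.HodgeConjecture.HodgeConjecture.Cruxes.H413.K2E1BLBorelSpacesU2Defs
open Summit.HodgeConjecture.HodgeConjecture.Cruxes.H413.K2E1BLBorelOperatorsU2Defs
open Summit.HodgeConjecture.HodgeConjecture.Cruxes.H413.K2E1CharacterEisensteinU2Defs
open Summit.HodgeConjecture.HodgeConjecture.Cruxes.H413.K2E1ChiSectionSpaceU2Defs
open Summit.HodgeConjecture.HodgeConjecture.Cruxes.H413.K2E1ChiEisensteinBallPackageCMThreeScalar (exists_chiPair_ball_package_cm_three_of_letters')
open Summit.HodgeConjecture.HodgeConjecture.Cruxes.H413.K2E1ChiEisensteinMeromorphicExportsU2Global (meromorphicOn_patch_of_coDiscrete)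
open Summit.HodgeConjecture.HodgeConjecture.Cruxes.H413.K2E1ChiEisensteinMeromorphicExportsU3Global (chiEisenstein_meromorphic_exports_core_of_packages_cm_three)
open Summit.HodgeConjecture.HodgeConjecture.Cruxes.H413.K2E1ChiEisensteinMeromorphicExportsU2GlobalCM (meromorphicOn_apply_of_pi)
open Summit.HodgeConjecture.HodgeConjecture.Cruxes.H413.K2E1CharacterEisensteinU3PairDefs (IsChiSectionPair)
open Summit.HodgeConjecture.HodgeConjecture.Cruxes.H413.K2E1BLIotaClosedEmbeddingU3 (iotaBound_cm_three)

namespace Summit.HodgeConjecture.HodgeConjecture.Cruxes.H413.K2E1ChiEisensteinMeromorphicExportsU3GlobalCM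

variable (L : Type) [Field L] [NumberField L] [IsCMField L]
  [MeasurableSpace (quasiSplit (↥(maximalRealSubfield L)) L (IsCMField.complexConj L) 3).Adelic] [BorelSpace (quasiSplit (↥(maximalRealSubfield L)) L (IsCMField.complexConj L) 3).Adelic]

/-- Totalisation of a conditional existential (one witness): from `p → ∃ a, Q a` to `∃ a, p → Q a` on a nonempty type. [folklore] -/
theorem exists_imp_of {A : Sort*} [Nonempty A] {p : Prop} {Q : A → Prop} (h : p → ∃ a, Q a) : ∃ a, p → Q a := by
  by_cases hp : p
  · obtain ⟨a, hQ⟩ := h hp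
    exact ⟨a, fun _ => hQ⟩
  · exact ⟨Classical.arbitrary A, fun h' => absurd h' hp⟩

/-- Totalisation of a conditional existential (six witnesses, the fourth a proof): from `p → ∃ a b c d e g, Q …` to `∃ a b c d e g, p → Q …` (used to make the per-ball
packages of ★ X1_χ §2c, which at `N = 3` exist for `0 < n`, total in the ball index). [folklore] -/
theorem exists₆_imp_of {A B C E G : Sort*} {D : Prop} [Nonempty A] [Nonempty B] [Nonempty C] [Nonempty E] [Nonempty G] (hD : D)
    {p : Prop} {Q : A → B → C → D → E → G → Prop} (h : p → ∃ (a : A) (b : B) (c : C) (d : D) (e : E) (g : G), Q a b c d e g) :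
    ∃ (a : A) (b : B) (c : C) (d : D) (e : E) (g : G), p → Q a b c d e g := by
  by_cases hp : p
  · obtain ⟨a, b, c, d, e, g, hQ⟩ := h hp
    exact ⟨a, b, c, d, e, g, fun _ => hQ⟩
  · exact ⟨Classical.arbitrary A, Classical.arbitrary B, Classical.arbitrary C, hD, Classical.arbitrary E, Classical.arbitrary G, fun h' => absurd h' hp⟩

/-- **X2_χ (A) AT THE CM PAIR — THE MEROMORPHIC CONTINUATION OF `E(f_z^φ)` AND OF ITS SCATTERING COORDINATES TO `ℂ`** (module docstring): (E1) `z ↦ Ec z g` and `qc_j` meromorphic in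
normal form on `ℂ`; (E2) `Ec z = E(f_z^φ)`, `qc_j z = q_j z` on `{2 < Re}`; (E3) one closed discrete pole set `P ⊆ {Re ≤ 2}` with analyticity off `P`; (E4) `g ↦ Ec z g` continuous off `P`.
Letters: `hCD` (per-ball convolution data with the scalar-action clause), `hq`, `hqφ`. [cite: BernsteinLapid2019, Thm 2.3, §2.1, §4, §7] [cite: MoeglinWaldspurger1995, IV.1.8–IV.1.11] -/
theorem chiEisenstein_meromorphic_exports_cm_three_of_letters
    (μ : Measure (quasiSplit (↥(maximalRealSubfield L)) L (IsCMField.complexConj L) 3).automorphicQuotient) [(quasiSplit (↥(maximalRealSubfield L)) L (IsCMField.complexConj L) 3).IsAutomorphicMeasure μ]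
    (νG : Measure (quasiSplit (↥(maximalRealSubfield L)) L (IsCMField.complexConj L) 3).Adelic) [νG.IsHaarMeasure] [νG.IsInvInvariant] [SFinite νG]
    (ν : Measure ↥(adelicUnipotent (↥(maximalRealSubfield L)) L (IsCMField.complexConj L) 3)) [ν.IsHaarMeasure] [ν.IsMulRightInvariant] [ν.IsInvInvariant]
    {𝓕 : Set ↥(adelicUnipotent (↥(maximalRealSubfield L)) L (IsCMField.complexConj L) 3)}
    (h𝓕N : IsFundamentalDomain ↥(rationalUnipotent (↥(maximalRealSubfield L)) L (IsCMField.complexConj L) 3) 𝓕 ν) (h𝓕c : IsCompact (closure 𝓕)) (h𝓕₀ : ν 𝓕 ≠ 0)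
    {β : (quasiSplit (↥(maximalRealSubfield L)) L (IsCMField.complexConj L) 3).Adelic → ℝ≥0∞}
    (hβ : IsCoveringWeight ↥((arithmeticBorel (↥(maximalRealSubfield L)) L (IsCMField.complexConj L) 3).map (quasiSplit (↥(maximalRealSubfield L)) L (IsCMField.complexConj L) 3).arithmeticSubgroup.subtype) β)
    {μZ : Measure (borelQuotient (↥(maximalRealSubfield L)) L (IsCMField.complexConj L) 3)} [SFinite μZ]
    (hμZ : ∀ f : borelQuotient (↥(maximalRealSubfield L)) L (IsCMField.complexConj L) 3 → ℝ≥0∞, Measurable f → ∫⁻ z, f z ∂μZ = ∫⁻ g, β g * f (toBorelQuotient (↥(maximalRealSubfield L)) L (IsCMField.complexConj L) 3 g) ∂νG)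
    -- the section data
    {χ₁ : HeckeCharacter L} {χ₂ : ↥(TorusDict.torus (IsCMField.complexConj L)) →ₜ* ℂˣ} (hχ₂ : TorusDict.IsAutomorphic (IsCMField.complexConj L) χ₂)
    {φ : (quasiSplit (↥(maximalRealSubfield L)) L (IsCMField.complexConj L) 3).Adelic → ℂ} (hφ : IsChiSectionPair χ₁ χ₂ φ) (hφc : Continuous φ) {Mφ : ℝ} (hφM : ∀ x, ‖φ x‖ ≤ Mφ)
    {χ₁' : HeckeCharacter L} {χ₂' : ↥(TorusDict.torus (IsCMField.complexConj L)) →ₜ* ℂˣ} (hχ₂' : TorusDict.IsAutomorphic (IsCMField.complexConj L) χ₂')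
    {ι' : Type} [Fintype ι'] {φ' : ι' → (quasiSplit (↥(maximalRealSubfield L)) L (IsCMField.complexConj L) 3).Adelic → ℂ} (hli : LinearIndependent ℂ φ') (hφ'c : ∀ j, Continuous (φ' j))
    (hφ'χ : ∀ j, IsChiSectionPair χ₁' χ₂' (φ' j)) {Mb : ℝ} (hφ'M : ∀ j x, ‖φ' j x‖ ≤ Mb)
    -- THE LETTERS `hq`∕`hqφ`: the scattering coordinates on the Godement half-plane
    (q : ι' → ℂ → ℂ) (hq : ∀ j, DifferentiableOn ℂ (q j) {z : ℂ | 2 < z.re})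
    (hqφ : ∀ z : ℂ, 2 < z.re → (∑ j, q j z • φ' j) = ((((ν 𝓕).toReal⁻¹ : ℝ)) : ℂ) • (fun g : (quasiSplit (↥(maximalRealSubfield L)) L (IsCMField.complexConj L) 3).Adelic => (∫ v : ↥(adelicUnipotent (↥(maximalRealSubfield L)) L (IsCMField.complexConj L) 3), flatSectionU φ z ((quasiSplit (↥(maximalRealSubfield L)) L (IsCMField.complexConj L) 3).toAdelic (weylLongU ((IsCMField.complexConj L : L ≃ₐ[↥(maximalRealSubfield L)] L) : L →+* L) (rfl : (StdForm.antidiagonal 3).over L = (StdForm.antidiagonal 3).over L)) * ((v : (quasiSplit (↥(maximalRealSubfield L)) L (IsCMField.complexConj L) 3).Adelic) * g)) ∂ν) * (((borelHeight g : ℝ) : ℂ) ^ (z - 2))))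
    -- THE LETTER BUNDLE `hCD`: per ball, the convolution data (★ convData clauses) WITH the scalar-action clause
    (hCD : ∀ n : ℕ, ∃ (I : Type) (_ : Fintype I) (i₀ : I) (η : I → GL (Fin 3) (AdeleRing (𝓞 L) L) → ℝ) (a : ℝ≥0) (ha : 0 < a) (κ : I → ℝ≥0) (T : I → HX (↥(maximalRealSubfield L)) L (IsCMField.complexConj L) 3 (n + 4) μ →L[ℂ] HX (↥(maximalRealSubfield L)) L (IsCMField.complexConj L) 3 (n + 4) μ),
      (∀ i, IsTestFunctionGL 3 L (η i)) ∧
      (∀ i, Continuous ((fun (i : I) (y : (quasiSplit (↥(maximalRealSubfield L)) L (IsCMField.complexConj L) 3).Adelic) => orbitalSmoothing νG (fun x : (quasiSplit (↥(maximalRealSubfield L)) L (IsCMField.complexConj L) 3).Adelic => ((η i (adelicVal (↥(maximalRealSubfield L)) L (IsCMField.complexConj L) 3 ((StdForm.antidiagonal 3).over L) x) : ℝ) : ℂ)) (fun x : (quasiSplit (↥(maximalRealSubfield L)) L (IsCMField.complexConj L) 3).Adelic => ((η i (adelicVal (↥(maximalRealSubfield L)) L (IsCMField.complexConj L) 3 ((StdForm.antidiagonal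 3).over L) x) : ℝ) : ℂ)) y) i) ∧ HasCompactSupport ((fun (i : I) (y : (quasiSplit (↥(maximalRealSubfield L)) L (IsCMField.complexConj L) 3).Adelic) => orbitalSmoothing νG (fun x : (quasiSplit (↥(maximalRealSubfield L)) L (IsCMField.complexConj L) 3).Adelic => ((η i (adelicVal (↥(maximalRealSubfield L)) L (IsCMField.complexConj L) 3 ((StdForm.antidiagonal 3).over L) x) : ℝ) : ℂ)) (fun x : (quasiSplit (↥(maximalRealSubfield L)) L (IsCMField.complexConj L) 3).Adelic => ((η i (adelicVal (↥(maximalRealSubfield L)) L (IsCMField.complexConj L) 3 ((StdForm.antidiagonal 3).over L) x) : ℝ) : ℂ)) y) i) ∧ (∀ g, (fun (i : I) (y : (quasiSplit (↥(maximalRealSubfield L)) L (IsCMField.complexConj L) 3).Adelic) => orbitalSmoothing νG (fun x : (quasiSplit (↥(maximalRealSubfield L)) L (IsCMField.complexConj L) 3).Adelic => ((η i (adelicVal (↥(maximalRealSubfield L)) L (IsCMField.complexConj L) 3 ((StdForm.antidiagonal 3).over L) x) : ℝ) : ℂ)) (fun x : (quasiSplit (↥(maximalRealSubfield L)) L (IsCMField.complexConj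 L) 3).Adelic => ((η i (adelicVal (↥(maximalRealSubfield L)) L (IsCMField.complexConj L) 3 ((StdForm.antidiagonal 3).over L) x) : ℝ) : ℂ)) y) i g⁻¹ = (fun (i : I) (y : (quasiSplit (↥(maximalRealSubfield L)) L (IsCMField.complexConj L) 3).Adelic) => orbitalSmoothing νG (fun x : (quasiSplit (↥(maximalRealSubfield L)) L (IsCMField.complexConj L) 3).Adelic => ((η i (adelicVal (↥(maximalRealSubfield L)) L (IsCMField.complexConj L) 3 ((StdForm.antidiagonal 3).over L) x) : ℝ) : ℂ)) (fun x : (quasiSplit (↥(maximalRealSubfield L)) L (IsCMField.complexConj L) 3).Adelic => ((η i (adelicVal (↥(maximalRealSubfield L)) L (IsCMField.complexConj L) 3 ((StdForm.antidiagonal 3).over L) x) : ℝ) : ℂ)) y) i g) ∧ (∀ g, conj ((fun (i : I) (y : (quasiSplit (↥(maximalRealSubfield L)) L (IsCMField.complexConj L) 3).Adelic) => orbitalSmoothing νG (fun x : (quasiSplit (↥(maximalRealSubfield L)) L (IsCMField.complexConj L) 3).Adelic => ((η i (adelicVal (↥(maximalRealSubfield L)) L (IsCMField.complexConj L) 3 ((StdForm.antidiagonal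 3).over L) x) : ℝ) : ℂ)) (fun x : (quasiSplit (↥(maximalRealSubfield L)) L (IsCMField.complexConj L) 3).Adelic => ((η i (adelicVal (↥(maximalRealSubfield L)) L (IsCMField.complexConj L) 3 ((StdForm.antidiagonal 3).over L) x) : ℝ) : ℂ)) y) i g) = (fun (i : I) (y : (quasiSplit (↥(maximalRealSubfield L)) L (IsCMField.complexConj L) 3).Adelic) => orbitalSmoothing νG (fun x : (quasiSplit (↥(maximalRealSubfield L)) L (IsCMField.complexConj L) 3).Adelic => ((η i (adelicVal (↥(maximalRealSubfield L)) L (IsCMField.complexConj L) 3 ((StdForm.antidiagonal 3).over L) x) : ℝ) : ℂ)) (fun x : (quasiSplit (↥(maximalRealSubfield L)) L (IsCMField.complexConj L) 3).Adelic => ((η i (adelicVal (↥(maximalRealSubfield L)) L (IsCMField.complexConj L) 3 ((StdForm.antidiagonal 3).over L) x) : ℝ) : ℂ)) y) i g) ∧ (∀ g, 0 ≤ ((fun (i : I) (y : (quasiSplit (↥(maximalRealSubfield L)) L (IsCMField.complexConj L) 3).Adelic) => orbitalSmoothing νG (fun x : (quasiSplit (↥(maximalRealSubfield L)) L (IsCMField.complexConj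 L) 3).Adelic => ((η i (adelicVal (↥(maximalRealSubfield L)) L (IsCMField.complexConj L) 3 ((StdForm.antidiagonal 3).over L) x) : ℝ) : ℂ)) (fun x : (quasiSplit (↥(maximalRealSubfield L)) L (IsCMField.complexConj L) 3).Adelic => ((η i (adelicVal (↥(maximalRealSubfield L)) L (IsCMField.complexConj L) 3 ((StdForm.antidiagonal 3).over L) x) : ℝ) : ℂ)) y) i g).re)) ∧
      (fun (i : I) (y : (quasiSplit (↥(maximalRealSubfield L)) L (IsCMField.complexConj L) 3).Adelic) => orbitalSmoothing νG (fun x : (quasiSplit (↥(maximalRealSubfield L)) L (IsCMField.complexConj L) 3).Adelic => ((η i (adelicVal (↥(maximalRealSubfield L)) L (IsCMField.complexConj L) 3 ((StdForm.antidiagonal 3).over L) x) : ℝ) : ℂ)) (fun x : (quasiSplit (↥(maximalRealSubfield L)) L (IsCMField.complexConj L) 3).Adelic => ((η i (adelicVal (↥(maximalRealSubfield L)) L (IsCMField.complexConj L) 3 ((StdForm.antidiagonal 3).over L) x) : ℝ) : ℂ)) y) i₀ 1 ≠ 0 ∧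
      (∀ z ∈ Metric.ball (0 : ℂ) (n + 2), ∃ i, (∫ x, (fun (i : I) (y : (quasiSplit (↥(maximalRealSubfield L)) L (IsCMField.complexConj L) 3).Adelic) => orbitalSmoothing νG (fun x : (quasiSplit (↥(maximalRealSubfield L)) L (IsCMField.complexConj L) 3).Adelic => ((η i (adelicVal (↥(maximalRealSubfield L)) L (IsCMField.complexConj L) 3 ((StdForm.antidiagonal 3).over L) x) : ℝ) : ℂ)) (fun x : (quasiSplit (↥(maximalRealSubfield L)) L (IsCMField.complexConj L) 3).Adelic => ((η i (adelicVal (↥(maximalRealSubfield L)) L (IsCMField.complexConj L) 3 ((StdForm.antidiagonal 3).over L) x) : ℝ) : ℂ)) y) i x * (((borelHeight x : ℝ≥0) : ℝ) : ℂ) ^ z ∂νG) ≠ 0) ∧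
      (∀ i, 1 ≤ κ i ∧ a ≤ κ i * a) ∧
      (∀ i, ∀ z : borelQuotient (↥(maximalRealSubfield L)) L (IsCMField.complexConj L) 3, ∀ y ∈ tsupport ((fun (i : I) (y : (quasiSplit (↥(maximalRealSubfield L)) L (IsCMField.complexConj L) 3).Adelic) => orbitalSmoothing νG (fun x : (quasiSplit (↥(maximalRealSubfield L)) L (IsCMField.complexConj L) 3).Adelic => ((η i (adelicVal (↥(maximalRealSubfield L)) L (IsCMField.complexConj L) 3 ((StdForm.antidiagonal 3).over L) x) : ℝ) : ℂ)) (fun x : (quasiSplit (↥(maximalRealSubfield L)) L (IsCMField.complexConj L) 3).Adelic => ((η i (adelicVal (↥(maximalRealSubfield L)) L (IsCMField.complexConj L) 3 ((StdForm.antidiagonal 3).over L) x) : ℝ) : ℂ)) y) i), borelQuotHeight (↥(maximalRealSubfield L)) L (IsCMField.complexConj L) 3 z ≤ κ i * borelQuotHeight (↥(maximalRealSubfield L)) L (IsCMField.complexConj L) 3 (rightShift (↥(maximalRealSubfield L)) L (IsCMField.complexConj L) 3 y z)) ∧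
      (∀ i, ∃ hpos : 0 < κ i * a, Function.Injective (iota (iotaBound_cm_three L μ νG hβ hμZ hpos (n + 4))) ∧
        IsClosed ((LinearMap.range (iota (iotaBound_cm_three L μ νG hβ hμZ hpos (n + 4))).toLinearMap : Submodule ℂ (HN (↥(maximalRealSubfield L)) L (IsCMField.complexConj L) 3 (n + 4) (κ i * a) μZ)) : Set (HN (↥(maximalRealSubfield L)) L (IsCMField.complexConj L) 3 (n + 4) (κ i * a) μZ))) ∧
      (∀ i, ∀ u : HX (↥(maximalRealSubfield L)) L (IsCMField.complexConj L) 3 (n + 4) μ, ((T i u : HX (↥(maximalRealSubfield L)) L (IsCMField.complexConj L) 3 (n + 4) μ) : (quasiSplit (↥(maximalRealSubfield L)) L (IsCMField.complexConj L) 3).automorphicQuotient → ℂ) =ᵐ[(μ.withDensity fun x => (((supHeight (↥(maximalRealSubfield L)) L (IsCMField.complexConj L) 3 x)⁻¹ ^ (2 * (n + 4)) : ℝ≥0) : ℝ≥0∞))] fun ξ => ∫ y, (fun (i : I) (y : (quasiSplit (↥(maximalRealSubfield L)) L (IsCMField.complexConj L) 3).Adelic) => orbitalSmoothing νG (fun x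 : (quasiSplit (↥(maximalRealSubfield L)) L (IsCMField.complexConj L) 3).Adelic => ((η i (adelicVal (↥(maximalRealSubfield L)) L (IsCMField.complexConj L) 3 ((StdForm.antidiagonal 3).over L) x) : ℝ) : ℂ)) (fun x : (quasiSplit (↥(maximalRealSubfield L)) L (IsCMField.complexConj L) 3).Adelic => ((η i (adelicVal (↥(maximalRealSubfield L)) L (IsCMField.complexConj L) 3 ((StdForm.antidiagonal 3).over L) x) : ℝ) : ℂ)) y) i y * (u : (quasiSplit (↥(maximalRealSubfield L)) L (IsCMField.complexConj L) 3).automorphicQuotient → ℂ) (y⁻¹ • ξ) ∂νG) ∧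
      (∀ i, ∃ hs : ShiftBound (↥(maximalRealSubfield L)) L (IsCMField.complexConj L) 3 (n + 4) a (κ i * a) νG μZ ((fun (i : I) (y : (quasiSplit (↥(maximalRealSubfield L)) L (IsCMField.complexConj L) 3).Adelic) => orbitalSmoothing νG (fun x : (quasiSplit (↥(maximalRealSubfield L)) L (IsCMField.complexConj L) 3).Adelic => ((η i (adelicVal (↥(maximalRealSubfield L)) L (IsCMField.complexConj L) 3 ((StdForm.antidiagonal 3).over L) x) : ℝ) : ℂ)) (fun x : (quasiSplit (↥(maximalRealSubfield L)) L (IsCMField.complexConj L) 3).Adelic => ((η i (adelicVal (↥(maximalRealSubfield L)) L (IsCMField.complexConj L) 3 ((StdForm.antidiagonal 3).over L) x) : ℝ) : ℂ)) y) i),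
        ∀ h01 : a ≤ κ i * a, deltaShift hs ∘L iota (iotaBound_cm_three L μ νG hβ hμZ ha (n + 4)) = restrHN (↥(maximalRealSubfield L)) L (IsCMField.complexConj L) 3 (n + 4) h01 μZ ∘L iota (iotaBound_cm_three L μ νG hβ hμZ ha (n + 4)) ∘L T i) ∧
      (∀ i (z : ℂ), 2 < z.re → ∀ x : (quasiSplit (↥(maximalRealSubfield L)) L (IsCMField.complexConj L) 3).Adelic, (∫ y, (fun (i : I) (y : (quasiSplit (↥(maximalRealSubfield L)) L (IsCMField.complexConj L) 3).Adelic) => orbitalSmoothing νG (fun x : (quasiSplit (↥(maximalRealSubfield L)) L (IsCMField.complexConj L) 3).Adelic => ((η i (adelicVal (↥(maximalRealSubfield L)) L (IsCMField.complexConj L) 3 ((StdForm.antidiagonal 3).over L) x) : ℝ) : ℂ)) (fun x : (quasiSplit (↥(maximalRealSubfield L)) L (IsCMField.complexConj L) 3).Adelic => ((η i (adelicVal (↥(maximalRealSubfield L)) L (IsCMField.complexConj L) 3 ((StdForm.antidiagonal 3).over L) x) : ℝ) : ℂ)) y) i y * flatSectionU φ z (x * y) ∂νG) = (∫ x, (fun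 (i : I) (y : (quasiSplit (↥(maximalRealSubfield L)) L (IsCMField.complexConj L) 3).Adelic) => orbitalSmoothing νG (fun x : (quasiSplit (↥(maximalRealSubfield L)) L (IsCMField.complexConj L) 3).Adelic => ((η i (adelicVal (↥(maximalRealSubfield L)) L (IsCMField.complexConj L) 3 ((StdForm.antidiagonal 3).over L) x) : ℝ) : ℂ)) (fun x : (quasiSplit (↥(maximalRealSubfield L)) L (IsCMField.complexConj L) 3).Adelic => ((η i (adelicVal (↥(maximalRealSubfield L)) L (IsCMField.complexConj L) 3 ((StdForm.antidiagonal 3).over L) x) : ℝ) : ℂ)) y) i x * (((borelHeight x : ℝ≥0) : ℝ) : ℂ) ^ z ∂νG) * flatSectionU φ z x)) :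
    ∃ (Ec : ℂ → (quasiSplit (↥(maximalRealSubfield L)) L (IsCMField.complexConj L) 3).Adelic → ℂ) (qc : ι' → ℂ → ℂ) (P : Set ℂ),
      (∀ g, MeromorphicNFOn (fun z => Ec z g) univ) ∧ (∀ j, MeromorphicNFOn (qc j) univ) ∧
      (∀ z : ℂ, 2 < z.re → Ec z = eisensteinSeriesU (flatSectionU φ z)) ∧ (∀ j (z : ℂ), 2 < z.re → qc j z = q j z) ∧
      IsClosed P ∧ (∀ z₀ : ℂ, ∀ᶠ s in 𝓝[≠] z₀, s ∉ P) ∧ (∀ z ∈ P, z.re ≤ 2) ∧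
      (∀ g (z : ℂ), z ∉ P → AnalyticAt ℂ (fun z => Ec z g) z) ∧ (∀ j (z : ℂ), z ∉ P → AnalyticAt ℂ (qc j) z) ∧
      (∀ g, DifferentiableOn ℂ (fun z => Ec z g) Pᶜ) ∧ (∀ j, DifferentiableOn ℂ (qc j) Pᶜ) ∧
      ∀ z : ℂ, z ∉ P → Continuous (Ec z) := by
  -- the per-ball convolution data, chosen over `n`
  choose I hI i₀ η a ha κ T hη hconv hh1 hcov hκ hcmp hι hT hpack hS1 using hCD
  -- the per-ball packages of ★ X1_χ §2c at the coordinates `bX z := (q_j z)_j`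
  -- (at `N = 3` the package of ball `n` exists for `0 < n` — `ball 0 2 ∩ {2 < Re} = ∅` —; the witnesses are made TOTAL in `n` by `exists₆_imp_of` ∕ `exists_imp_of`, and only `1 ≤ n` is ever consumed)
  have P0 := fun n : ℕ => exists₆_imp_of (iotaBound_cm_three L μ νG hβ hμZ (ha n) (n + 4)) fun hn : 0 < n =>
    exists_chiPair_ball_package_cm_three_of_letters' L μ νG ν h𝓕N h𝓕c h𝓕₀ hβ hμZ n hn (i₀ n) (η n) (ha n) (κ n) (T n) (hη n) (hconv n) (hh1 n) (hcov n) (hκ n)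
      (hcmp n) (hι n) (hT n) (hpack n) hχ₂ hφ hφc hφM hχ₂' hli hφ'c hφ'χ hφ'M (fun z j => q j z) (fun z _ hz1 => hqφ z hz1) (hS1 n)
  choose U vX cc hb α₁ col hP using P0
  choose hUo hUD hDcl hUcd hvXd hvXm hccd hccm hα₁ae hcolae heqs hunq hgod hR4 using hP
  have hR4' := fun (n : ℕ) (g : (quasiSplit (↥(maximalRealSubfield L)) L (IsCMField.complexConj L) 3).Adelic) => exists_imp_of fun hn : 0 < n => hR4 n hn g
  choose Ecb hR4'' using hR4'
  choose hEcm hEcg hEco hgerm using hR4''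
  have hp : ∀ n : ℕ, 1 ≤ n → 0 < n := fun n hn => Nat.pos_of_ne_zero (Nat.one_le_iff_ne_zero.1 hn)
  -- the coefficient pieces: the components of `cc n`, patched to `q_j` on the Godement half-plane (★ `meromorphicOn_patch_of_coDiscrete`)
  have hpatch : ∀ (j : ι') (n : ℕ), 0 < n → MeromorphicOn (fun s => if (2 : ℝ) < s.re then q j s else cc n s j) (Metric.ball (0 : ℂ) (n + 2)) ∧
      (∀ z ∈ Metric.ball (0 : ℂ) (n + 2), (2 : ℝ) < z.re → (fun s => if (2 : ℝ) < s.re then q j s else cc n s j) z = q j z) ∧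
      ∀ z ∈ Metric.ball (0 : ℂ) (n + 2), z ∈ U n → 0 ≤ meromorphicOrderAt (fun s => if (2 : ℝ) < s.re then q j s else cc n s j) z := fun j n hn =>
    (meromorphicOn_patch_of_coDiscrete (hUo n hn) (hUcd n hn) (σ₀ := (2 : ℝ)) (cc := fun z => cc n z j) (q := q j) (differentiableOn_pi.1 (hccd n hn) j)
      (meromorphicOn_apply_of_pi (hccm n hn) j) (fun z hz hz1 => by rw [(hgod n hn z hz hz1).2])).2
  -- ONE call of ★ X2_χ core
  obtain ⟨Ec, qc, P, hEcNF, hqcNF, hEcE, hqcq, -, -, hPc, hPcd, hPre, -, hEan, hqan, hEdiff, hqdiff, -, hEcont⟩ :=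
    chiEisenstein_meromorphic_exports_core_of_packages_cm_three L μ νG hφc hφM 1 le_rfl (fun n => n + 4) (I := I) (fun n i => (fun (i : I n) (y : (quasiSplit (↥(maximalRealSubfield L)) L (IsCMField.complexConj L) 3).Adelic) => orbitalSmoothing νG (fun x : (quasiSplit (↥(maximalRealSubfield L)) L (IsCMField.complexConj L) 3).Adelic => ((η n i (adelicVal (↥(maximalRealSubfield L)) L (IsCMField.complexConj L) 3 ((StdForm.antidiagonal 3).over L) x) : ℝ) : ℂ)) (fun x : (quasiSplit (↥(maximalRealSubfield L)) L (IsCMField.complexConj L) 3).Adelic => ((η n i (adelicVal (↥(maximalRealSubfield L)) L (IsCMField.complexConj L) 3 ((StdForm.antidiagonal 3).over L) x) : ℝ) : ℂ)) y) i)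
      (fun n i => (hconv n i).1) (fun n i => (hconv n i).2.1) (fun n i x => (hconv n i).2.2.2.1 x) (fun n _ => hcov n)
      (U := U) (fun n hn => hUo n (hp n hn)) (fun n hn => hUD n (hp n hn)) (fun n hn => hUcd n (hp n hn)) vX (fun n hn => hvXd n (hp n hn))
      (F := fun g n => Ecb n g) (fun g n hn => hEcm n g (hp n hn)) (fun g n hn => hEcg n g (hp n hn)) (fun g n hn z _ hzU => hEco n g (hp n hn) z hzU) (fun g n hn => hgerm n g (hp n hn))
      (q := q) hq (Fq := fun j n s => if (2 : ℝ) < s.re then q j s else cc n s j) (fun j n hn => (hpatch j n (hp n hn)).1) (fun j n hn => (hpatch j n (hp n hn)).2.1)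
      (fun j n hn => (hpatch j n (hp n hn)).2.2)
  exact ⟨Ec, qc, P, hEcNF, hqcNF, hEcE, hqcq, hPc, hPcd, hPre, hEan, hqan, hEdiff, hqdiff, hEcont⟩

end Summit.HodgeConjecture.HodgeConjecture.Cruxes.H413.K2E1ChiEisensteinMeromorphicExportsU3GlobalCM

end
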